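import Summits.BirchSwinnertonDyer.Rank1Residual.X2.SplitCellCClassIntPNewNotGV
import Summits.BirchSwinnertonDyer.Rank1Residual.X2.ManinEtaleSwitchChain
import Summits.BirchSwinnertonDyer.Rank1Residual.X2.TwistParityStability
import Summits.BirchSwinnertonDyer.Rank1Residual.Partition.GreenbergVatsalIsogenyClassPeriod
import Literature.NumberTheory.EllipticCurves.MazurTorsionGaloisStructureProofs
import HarnessLib

/-!
# Row B11 ∩ SPLIT at `p ≥ 5` — the ÉTALE-SWITCH DISPLAY KIT: `BSD(E,p)` on a whole `ℚ`-isogeny class from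
# ONE explicit `p`-isogeny (or a two-step chain) out of the curve carrying the Manin datum, with the
# Galois side READ OFF the isogeny (cell `bsd-eis`, seat `bsd-eis-cgshw` g9; route `EisensteinPrimes`,
# crux 4 `BSDpOnCellC` = stmt-BirchSwinnertonDyer-19034, line b1 skeleton v7, stub `stub_ctlOrSwitch`;
# abstracts the pilot `X2/RankOneSplitSwitchDisplay155a{Local,}.lean` (p442722/p442846); THEOREMS ONLY)

HONEST FRAMING (cell `bsd-eis`, run/shared/lean/pub/bsd-eis/): theorems only; nothing booked; X2 stays
CONSTRUCTION-SHAPED; no label or count moves. The pilot at the class `155a` (`p = 5`) spelled out the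
switch disjunct of `stub_ctlOrSwitch` with ~500 kernel lines, most of them generic. This file isolates
the generic part so that a further class costs only its certificates (`IsogenyCert`, reduction types,
two valuations) — the per-class inputs being exactly: [instrument] `r_an = 1` at the étale end and
`HasPrimeToManinDatum` at the source of the isogeny (the optimal curve: Mazur, or Cremona's `c = 1`);
[PRE] Keller–Yin's IMC `SplitIMCEqOnTreeInt` at the étale end; [PUB] the 24 named facts + Tate
uniformisation ×2 + Ogg–Saito in Galois form + the DD15/Stevens Manin transport (cited fact p436778,
referee g26 W-g16-2 PASS 3/3); and, on a ψ-ODD class, Mazur's main conjecture at the CGLS partner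
(crux 3 ∩ split).

* `not_hasIrreducibleModPGaloisRep_of_isogeny_degree_eq` — **a `ℚ`-isogeny of prime degree `p` makes
  `E[p]` reducible** (its kernel meets `E[p]` in a rational line: `#E[p] = p² > p = #ker`; tree
  `GVPeriod.isRationalLine_ker_inf_torsion`). So NO Galois-side certificate is needed beyond the isogeny.
* `bsdp_of_isIsogenous_of_etaleStep_of_nsmul_eq_zero` — ψ-EVEN classes (a rational point of order `p`
  on the source: type A by `X2.not_gvPar_of_nsmul_eq_zero_of_mult`): `∀ W ∼ W₀, BSD(W,p)` from one étale
  step `φ : W₀ → W₁` (`deg φ = p`, `W₀` multiplicative and `W₁` split at `p`, `v_p j(W₀) = p·v_p j(W₁)`,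
  `p ∤ v_p Δ_min(W₁)`) + the inputs above; NO crux 3, NO c2, NO CTL input.
* `bsdp_of_isIsogenous_of_etaleStep_of_mazurMC` — ψ-ODD (or unknown parity) classes: the same with
  Mazur's MC on X2b ∩ {split} (crux 3) in place of the torsion point; the Galois side from `φ` alone.
* `bsdp_of_isIsogenous_of_etaleChain2_of_mazurMC` — the same along a two-step étale chain
  `W₀ → W₁ → W₂` (`switchDatum`-style data at both steps; referee g25's 37 chain-only window classes @3
  are the intended clients once a value input at `p = 3` exists — at `p ≥ 5` the statement is ready).

References: [DokchitserDokchitser2015LocalInvariants] Prop. 4.10, Lemma 4.3, Thm. A.1; [Stevens1989Invent]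
§1 (1.6), §2 Lemma (2.2); [Castella2018Exceptional] Thms. 2.10–2.11; [KellerYin2024] Thm. 5.1.3 (PRE);
[CastellaEtAl2021] Thm. 5.3.1; [GreenbergVatsal2000] Thm. (1.3); [SilvermanATAEC1994] IV.10–11, V.5.3–5.4;
[SilvermanAEC2009] III.4.8–4.10, VII.5.1; [Mazur1977] III §5 p. 157; [Mazur1978] Cor. 4.1; [MilneADT2006] I.7.3.
-/

set_option autoImplicit false

noncomputable section

open scoped Classical MatrixGroups ModularForm

open CongruenceSubgroup WeierstrassCurve NumberField IsDedekindDomain Field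
  Literature.NumberTheory.EllipticCurves Literature.NumberTheory.EllipticCurves.GreenbergSelmer
  Literature.NumberTheory.EllipticCurves.ModularForms Literature.NumberTheory.QuadraticFields
  Literature.NumberTheory.EllipticCurves.Rank1Residual
  Literature.NumberTheory.EllipticCurves.Rank1Residual.Typed
  Literature.NumberTheory.EllipticCurves.KrizLi2019
  Literature.NumberTheory.EllipticCurves.GreenbergVatsal2000
  Literature.NumberTheory.EllipticCurves.Wuthrich2014
  Literature.NumberTheory.EllipticCurves.SteinWuthrich2013
  Literature.NumberTheory.EllipticCurves.Castella2018
  Literature.NumberTheory.EllipticCurves.Castella2018Exceptional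
  Literature.NumberTheory.GaloisRepresentations Literature.NumberTheory.GaloisCohomology
  Literature.NumberTheory.Automorphic
  Summit.BirchSwinnertonDyer.Rank1Residual.X11b.AcSelmer
  Summit.BirchSwinnertonDyer.Rank1Residual.X11b.Halves
  Summit.BirchSwinnertonDyer.Rank1Residual.X11b
  Summit.BirchSwinnertonDyer.Rank1Residual

namespace Summit.BirchSwinnertonDyer.Rank1Residual.X2

/-! ### The Galois side off the isogeny -/

section Galois

variable {W W' : WeierstrassCurve ℚ} [W.IsElliptic] [W'.IsElliptic] {p : ℕ} [Fact p.Prime]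

omit [W'.IsElliptic] in
/-- **A `ℚ`-isogeny of prime degree `p` makes `E[p]` reducible.** `ker φ` has `p = deg φ` geometric
points while `#E[p] = p²`, so some `p`-torsion point is not killed; then `ker φ ∩ E[p]` is a rational
`p`-line (`GVPeriod.isRationalLine_ker_inf_torsion`) and `E[p]` is reducible
(`not_hasIrreducibleModPGaloisRep_of_isRationalLine`). [cite: SilvermanAEC2009, Thm. III.4.10 and Cor. III.6.4(b)]
[cite: GreenbergVatsal2000, p. 4 (rational p-isogeny kernels)] -/
theorem not_hasIrreducibleModPGaloisRep_of_isogeny_degree_eq (φ : Isogeny W W') (hdeg : φ.degree = p) :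
    ¬ W.HasIrreducibleModPGaloisRep p := by
  have hp : p.Prime := Fact.out
  have hne : ∃ P : geomPoints W, P ∈ geomTorsion W (p : ℤ) ∧ φ P ≠ 0 := by
    by_contra h
    push Not at h
    have hle : geomTorsion W (p : ℤ) ≤ φ.toAddMonoidHom.ker := fun P hP ↦ by
      rw [AddMonoidHom.mem_ker]; exact h P hP
    have hcard := AddSubgroup.card_le_of_le hle
    rw [Rank1Residual.natCard_geomTorsion W p] at hcard
    change p ^ 2 ≤ φ.degree at hcard
    rw [hdeg] at hcard
    have : p < p ^ 2 := by
      calc p = p ^ 1 := (pow_one p).symm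
        _ < p ^ 2 := Nat.pow_lt_pow_right hp.one_lt (by norm_num)
    omega
  exact not_hasIrreducibleModPGaloisRep_of_isRationalLine
    (GVPeriod.isRationalLine_ker_inf_torsion φ (hdeg ▸ dvd_rfl) hne)

end Galois

/-! ### One étale step, ψ-even class (rational `p`-torsion at the source) -/

section OneStep

variable {W₀ W₁ : WeierstrassCurve ℚ} [W₀.IsElliptic] [W₀.IsGloballyMinimal] [W₁.IsElliptic]
  [W₁.IsGloballyMinimal] {p : ℕ} [Fact p.Prime]

/-- **KIT, ψ-even: `BSD(W, p)` for every curve of the class from ONE étale `p`-step out of the curve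
carrying the Manin datum and a rational point of order `p` on it.** Data: `φ : W₀ → W₁` of degree `p`,
`W₀` multiplicative and `W₁` SPLIT multiplicative at `p ≥ 5`, `v_p j(W₀) = p·v_p j(W₁)` (the étale
direction), `p ∤ v_p Δ_min(W₁)` (so `W₁(ℚ_p)[p] = 0`), `P ∈ W₀(ℚ)` with `P ≠ O`, `p • P = O`. Inputs:
[PUB] the named facts (`hGV … hCassels`, `hT hT'`, Ogg–Saito `hOS`, DD15/Stevens `hDS`); [PRE]
`h3 : SplitIMCEqOnTreeInt W₁ p`; [per class] `hr : r_an(W₁) = 1`, `hMan₀ : HasPrimeToManinDatum W₀ p`.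
Proof: `E[p]` reducible off `φ`; type A from the torsion point (`not_gvPar_of_nsmul_eq_zero_of_mult`),
parity transported along `φ` (`gvPar_iff_of_isIsogenous_of_mult`); Manin datum along `φ`
(`hasPrimeToManinDatum_of_pIsogeny`, conductor by Ogg–Saito); CTL-split at `W₁` is the THEOREM
`splitControlOnTree_of_cellC_of_noPadicPTorsion`; `bsdp_of_cellCSplitNotGV_of_manin_of_pNewValue_of_imcInt_of_ctl`
(value half FROM PRINT, partner in the closed sub-cell X2a); Cassels. NO crux 3, NO c2, NO CTL input.
CONDITIONAL on the listed binders; nothing booked.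
[cite: DokchitserDokchitser2015LocalInvariants, Prop. 4.10 (p. 4348) and Thm. A.1 (p. 4354)]
[cite: Stevens1989Invent, §2 Lemma (2.2)] [cite: Castella2018Exceptional, Thm. 2.10 and Thm. 2.11]
[cite: GreenbergVatsal2000, Thm. (1.3) and §2 p. 28] [cite: SilvermanATAEC1994, Exercise 4.40, Thm. V.5.3 and Cor. V.5.4]
[claim: KellerYin2024, status: under-review] [cite: MilneADT2006, Thm. I.7.3] [cite: Miller2011LMS, Def. 1.1] -/
theorem bsdp_of_isIsogenous_of_etaleStep_of_nsmul_eq_zero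
    (hGV : lambdaMu_multiplicative_of_gvPar) (hWu : thm16_charIdeal_dvd_multiplicative_of_reducible)
    (hJs : thm61_splitMultiplicative) (hJn : thm61_nonsplitMultiplicative)
    (hHs : exists_isSplitMultCanonical) (hHn : exists_isMultCanonical)
    (hpar : nonempty_modularParametrizationData)
    (hGS : ∀ (W : WeierstrassCurve ℚ) [W.IsElliptic] [W.IsGloballyMinimal] (p : ℕ) [Fact p.Prime],
      greenberg_stevens (W := W) (p := p))
    (hnf : exists_isNewformOf)
    (hPT : ∀ (K : Type) [Field K] [NumberField K], poitouTate_selmerStructure_duality K)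
    (hPT2 : ∀ (K : Type) [Field K] [NumberField K], poitouTate_sha_tateDual K)
    (hEP : ∀ (K : Type) [Field K] [NumberField K] (v : HeightOneSpectrum (𝓞 K)),
      localEulerPoincareCharacteristic (v.adicCompletion K))
    (hcd : fieldCdLE_two_of_numberField)
    (hBr : ∀ (K : Type) [Field K] [NumberField K] (p : ℕ) [Fact p.Prime],
      ZpExtension.decomp_not_le_kerSubgroup_of_isAnticyclotomic K p)
    (hH : hsieh2014_exists_anticyclotomicPAdicLFunction) (hCS : thm210_thm211_bdpDisplay_pNew)
    (hGZ : ∀ (N : ℕ) [NeZero N] (W : WeierstrassCurve ℚ) (K : Type) [Field K] [NumberField K],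
      gross_zagier N W K)
    (hKo : ∀ (N : ℕ) [NeZero N] (W : WeierstrassCurve ℚ) (K : Type) [Field K] [NumberField K],
      kolyvagin N W K)
    (hHP : ∀ (N : ℕ) [NeZero N] (W : WeierstrassCurve ℚ) (K : Type) [Field K] [NumberField K],
      heegnerPointComplex_mem_range_map N W K)
    (hGZK : rank_eq_analyticRank_of_analyticRank_le_one) (hHL : HoffsteinLuo1997_exists_twist_L_one_ne_zero)
    (hCassels : bsdRHS_eq_of_isIsogenous)
    (hT : Silverman1994_thmV53_tateUniformisation.{0}) (hT' : Silverman1994_thmV53_corV54_tateUniformisation.{0})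
    (hOS : ∀ (W : WeierstrassCurve ℚ) (ℓ : ℕ) [Fact ℓ.Prime],
      W.artinConductorExponent_tate_eq_conductorExponent_of_isElliptic ℓ)
    (hDS : dokchitserStevens_maninDatum_of_pIsogeny)
    (hp5 : 5 ≤ p) (φ : Isogeny W₀ W₁) (hdeg : φ.degree = p)
    (hmult₀ : W₀.HasMultiplicativeReductionAtPrime p) (hs₁ : W₁.HasSplitMultiplicativeReductionAtPrime p)
    (hj : padicValRat p W₀.j = p * padicValRat p W₁.j)
    (hv : ¬ p ∣ padicValInt p W₁.minimalDiscriminantInt)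
    (P : W₀.toAffine.Point) (hP0 : P ≠ 0) (hpP : p • P = 0)
    (hr : W₁.analyticRank = 1) (hMan₀ : HasPrimeToManinDatum W₀ p) (h3 : SplitIMCEqOnTreeInt W₁ p)
    (W : WeierstrassCurve ℚ) [W.IsElliptic] [W.IsGloballyMinimal] (hW : IsIsogenous W W₀) : BSDp W p := by
  have hp : p.Prime := Fact.out
  have hp2 : p ≠ 2 := by omega
  have hmod : hasEntireLFunction_rat := hasEntireLFunction_rat_of_exists_isNewformOf hnf
  have hiso : IsIsogenous W₀ W₁ := ⟨φ⟩
  -- the Galois side off the isogeny and the torsion point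
  have hred₁ : ¬ W₁.HasIrreducibleModPGaloisRep p :=
    not_hasIrreducibleModPGaloisRep_of_isIsogenous hiso
      (not_hasIrreducibleModPGaloisRep_of_isogeny_degree_eq φ hdeg)
  have hngv₀ : ¬ GVPar W₀ p := not_gvPar_of_nsmul_eq_zero_of_mult W₀ hT hT' hp2 hmult₀ P hP0 hpP
  have hngv₁ : ¬ GVPar W₁ p := fun h ↦
    hngv₀ ((gvPar_iff_of_isIsogenous_of_mult hT hT' hp2 hmult₀ hiso).mpr h)
  have hc₁ : CellC W₁ p := ⟨hr, hp2, hred₁, hs₁.hasMultiplicativeReductionAtPrime⟩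
  -- the Manin datum along the étale step (DD15/Stevens; conductor by Ogg–Saito)
  have hMan₁ : HasPrimeToManinDatum W₁ p :=
    hasPrimeToManinDatum_of_pIsogeny hDS hMan₀ φ hdeg hmult₀ hj
      (conductorNorm_eq_of_isIsogenous_of_tate hOS W₀ W₁ hiso).symm
  -- no local `p`-torsion at the étale end: CTL-split is a theorem there
  have h0 : ∀ Q₀ : (W₁.baseChange ℚ_[p]).toAffine.Point, p • Q₀ = 0 → Q₀ = 0 :=
    X11b.LocalTorsion.localTorsion_eq_zero_of_mult W₁ p (by omega) hc₁.2.2.2 (Or.inr hv)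
  have hCTL₁ : SplitControlOnTree W₁ p :=
    splitControlOnTree_of_cellC_of_noPadicPTorsion W₁ p hGZK hnf hPT hPT2 hEP hcd hBr hc₁ h0
  -- the ψ-even split road at the étale end, then Cassels
  have hb₁ : BSDp W₁ p :=
    bsdp_of_cellCSplitNotGV_of_manin_of_pNewValue_of_imcInt_of_ctl W₁ p hGV hWu hJs hJn hHs hHn hpar hGS
      hnf hH hCS hGZ hKo hHP hGZK hHL hp5 ⟨hc₁, hs₁, hngv₁⟩ hMan₁ h3 hCTL₁
  exact bsdp_of_isIsogenous_of_bsdp hCassels hGZK hmod W₁ W (hW.trans' hiso).symm_of_charZero p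
    (by rw [hc₁.1]) hb₁

/-- **KIT, any parity: the same with Mazur's main conjecture on X2b ∩ {split} (crux 3) for the CGLS
partner** instead of a torsion point — the Galois side (`E[p]` reducible) is read off `φ` alone
(`not_hasIrreducibleModPGaloisRep_of_isogeny_degree_eq`). CONDITIONAL on the listed binders;
nothing booked. [cite: DokchitserDokchitser2015LocalInvariants, Prop. 4.10 (p. 4348) and Thm. A.1 (p. 4354)]
[cite: Stevens1989Invent, §2 Lemma (2.2)] [cite: Castella2018Exceptional, Thm. 2.10 and Thm. 2.11]
[cite: SilvermanATAEC1994, Exercise 4.40 with §IV.10] [claim: KellerYin2024, status: under-review]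
[cite: CastellaEtAl2021, Thm. 5.3.1] [cite: MilneADT2006, Thm. I.7.3] [cite: Miller2011LMS, Def. 1.1] -/
theorem bsdp_of_isIsogenous_of_etaleStep_of_mazurMC
    (hGV : lambdaMu_multiplicative_of_gvPar) (hWu : thm16_charIdeal_dvd_multiplicative_of_reducible)
    (hJs : thm61_splitMultiplicative) (hJn : thm61_nonsplitMultiplicative)
    (hHs : exists_isSplitMultCanonical) (hHn : exists_isMultCanonical)
    (hpar : nonempty_modularParametrizationData)
    (hGS : ∀ (W : WeierstrassCurve ℚ) [W.IsElliptic] [W.IsGloballyMinimal] (p : ℕ) [Fact p.Prime],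
      greenberg_stevens (W := W) (p := p))
    (hnf : exists_isNewformOf)
    (hPT : ∀ (K : Type) [Field K] [NumberField K], poitouTate_selmerStructure_duality K)
    (hPT2 : ∀ (K : Type) [Field K] [NumberField K], poitouTate_sha_tateDual K)
    (hEP : ∀ (K : Type) [Field K] [NumberField K] (v : HeightOneSpectrum (𝓞 K)),
      localEulerPoincareCharacteristic (v.adicCompletion K))
    (hcd : fieldCdLE_two_of_numberField)
    (hBr : ∀ (K : Type) [Field K] [NumberField K] (p : ℕ) [Fact p.Prime],
      ZpExtension.decomp_not_le_kerSubgroup_of_isAnticyclotomic K p)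
    (hH : hsieh2014_exists_anticyclotomicPAdicLFunction) (hCS : thm210_thm211_bdpDisplay_pNew)
    (hGZ : ∀ (N : ℕ) [NeZero N] (W : WeierstrassCurve ℚ) (K : Type) [Field K] [NumberField K],
      gross_zagier N W K)
    (hKo : ∀ (N : ℕ) [NeZero N] (W : WeierstrassCurve ℚ) (K : Type) [Field K] [NumberField K],
      kolyvagin N W K)
    (hHP : ∀ (N : ℕ) [NeZero N] (W : WeierstrassCurve ℚ) (K : Type) [Field K] [NumberField K],
      heegnerPointComplex_mem_range_map N W K)
    (hGZK : rank_eq_analyticRank_of_analyticRank_le_one) (hHL : HoffsteinLuo1997_exists_twist_L_one_ne_zero)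
    (hCassels : bsdRHS_eq_of_isIsogenous)
    (hOS : ∀ (W : WeierstrassCurve ℚ) (ℓ : ℕ) [Fact ℓ.Prime],
      W.artinConductorExponent_tate_eq_conductorExponent_of_isElliptic ℓ)
    (hDS : dokchitserStevens_maninDatum_of_pIsogeny)
    (hp5 : 5 ≤ p) (φ : Isogeny W₀ W₁) (hdeg : φ.degree = p)
    (hmult₀ : W₀.HasMultiplicativeReductionAtPrime p) (hs₁ : W₁.HasSplitMultiplicativeReductionAtPrime p)
    (hj : padicValRat p W₀.j = p * padicValRat p W₁.j)
    (hv : ¬ p ∣ padicValInt p W₁.minimalDiscriminantInt)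
    (hMCB : ∀ (W' : WeierstrassCurve ℚ) [W'.IsElliptic] [W'.IsGloballyMinimal],
      CellB W' p → W'.HasSplitMultiplicativeReductionAtPrime p → MazurMainConjectureAt W' p)
    (hr : W₁.analyticRank = 1) (hMan₀ : HasPrimeToManinDatum W₀ p) (h3 : SplitIMCEqOnTreeInt W₁ p)
    (W : WeierstrassCurve ℚ) [W.IsElliptic] [W.IsGloballyMinimal] (hW : IsIsogenous W W₀) : BSDp W p := by
  have hp : p.Prime := Fact.out
  have hp2 : p ≠ 2 := by omega
  have hmod : hasEntireLFunction_rat := hasEntireLFunction_rat_of_exists_isNewformOf hnf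
  have hiso : IsIsogenous W₀ W₁ := ⟨φ⟩
  have hred₁ : ¬ W₁.HasIrreducibleModPGaloisRep p :=
    not_hasIrreducibleModPGaloisRep_of_isIsogenous hiso
      (not_hasIrreducibleModPGaloisRep_of_isogeny_degree_eq φ hdeg)
  have hc₁ : CellC W₁ p := ⟨hr, hp2, hred₁, hs₁.hasMultiplicativeReductionAtPrime⟩
  have hMan₁ : HasPrimeToManinDatum W₁ p :=
    hasPrimeToManinDatum_of_pIsogeny hDS hMan₀ φ hdeg hmult₀ hj
      (conductorNorm_eq_of_isIsogenous_of_tate hOS W₀ W₁ hiso).symm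
  have h0 : ∀ Q₀ : (W₁.baseChange ℚ_[p]).toAffine.Point, p • Q₀ = 0 → Q₀ = 0 :=
    X11b.LocalTorsion.localTorsion_eq_zero_of_mult W₁ p (by omega) hc₁.2.2.2 (Or.inr hv)
  have hCTL₁ : SplitControlOnTree W₁ p :=
    splitControlOnTree_of_cellC_of_noPadicPTorsion W₁ p hGZK hnf hPT hPT2 hEP hcd hBr hc₁ h0
  have hb₁ : BSDp W₁ p :=
    bsdp_of_cellC_of_split_of_manin_of_pNewValue_of_imcInt_of_ctl W₁ p hGV hWu hJs hJn hHs hHn hpar hGS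
      hnf hH hCS hGZ hKo hHP hGZK hHL hp5 hc₁ hs₁ hMan₁ h3 hCTL₁ hMCB
  exact bsdp_of_isIsogenous_of_bsdp hCassels hGZK hmod W₁ W (hW.trans' hiso).symm_of_charZero p
    (by rw [hc₁.1]) hb₁

end OneStep

/-! ### Two étale steps, any parity -/

section TwoStep

variable {W₀ W₁ W₂ : WeierstrassCurve ℚ} [W₀.IsElliptic] [W₀.IsGloballyMinimal] [W₁.IsElliptic]
  [W₁.IsGloballyMinimal] [W₂.IsElliptic] [W₂.IsGloballyMinimal] {p : ℕ} [Fact p.Prime]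

/-- **KIT, two-step chain, any parity: `BSD(W, p)` for every curve of the class from an étale chain
`W₀ → W₁ → W₂`** (each step of degree `p`, sources multiplicative at `p`, `v_p j` dropping by the
factor `p`), `W₂` split with `p ∤ v_p Δ_min(W₂)`, the Manin datum at `W₀`, `r_an(W₂) = 1`,
Keller–Yin's IMC at `W₂`, and crux 3 at the partner (`hasPrimeToManinDatum_of_pIsogeny_chain2`,
p439972). CONDITIONAL on the listed binders; nothing booked.
[cite: DokchitserDokchitser2015LocalInvariants, Prop. 4.10 (p. 4348) and Thm. A.1 (p. 4354)]
[cite: Stevens1989Invent, §2 Lemma (2.2)] [cite: SilvermanAEC2009, IX.6 Example 6.4]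
[claim: KellerYin2024, status: under-review] [cite: MilneADT2006, Thm. I.7.3] [cite: Miller2011LMS, Def. 1.1] -/
theorem bsdp_of_isIsogenous_of_etaleChain2_of_mazurMC
    (hGV : lambdaMu_multiplicative_of_gvPar) (hWu : thm16_charIdeal_dvd_multiplicative_of_reducible)
    (hJs : thm61_splitMultiplicative) (hJn : thm61_nonsplitMultiplicative)
    (hHs : exists_isSplitMultCanonical) (hHn : exists_isMultCanonical)
    (hpar : nonempty_modularParametrizationData)
    (hGS : ∀ (W : WeierstrassCurve ℚ) [W.IsElliptic] [W.IsGloballyMinimal] (p : ℕ) [Fact p.Prime],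
      greenberg_stevens (W := W) (p := p))
    (hnf : exists_isNewformOf)
    (hPT : ∀ (K : Type) [Field K] [NumberField K], poitouTate_selmerStructure_duality K)
    (hPT2 : ∀ (K : Type) [Field K] [NumberField K], poitouTate_sha_tateDual K)
    (hEP : ∀ (K : Type) [Field K] [NumberField K] (v : HeightOneSpectrum (𝓞 K)),
      localEulerPoincareCharacteristic (v.adicCompletion K))
    (hcd : fieldCdLE_two_of_numberField)
    (hBr : ∀ (K : Type) [Field K] [NumberField K] (p : ℕ) [Fact p.Prime],
      ZpExtension.decomp_not_le_kerSubgroup_of_isAnticyclotomic K p)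
    (hH : hsieh2014_exists_anticyclotomicPAdicLFunction) (hCS : thm210_thm211_bdpDisplay_pNew)
    (hGZ : ∀ (N : ℕ) [NeZero N] (W : WeierstrassCurve ℚ) (K : Type) [Field K] [NumberField K],
      gross_zagier N W K)
    (hKo : ∀ (N : ℕ) [NeZero N] (W : WeierstrassCurve ℚ) (K : Type) [Field K] [NumberField K],
      kolyvagin N W K)
    (hHP : ∀ (N : ℕ) [NeZero N] (W : WeierstrassCurve ℚ) (K : Type) [Field K] [NumberField K],
      heegnerPointComplex_mem_range_map N W K)
    (hGZK : rank_eq_analyticRank_of_analyticRank_le_one) (hHL : HoffsteinLuo1997_exists_twist_L_one_ne_zero)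
    (hCassels : bsdRHS_eq_of_isIsogenous)
    (hOS : ∀ (W : WeierstrassCurve ℚ) (ℓ : ℕ) [Fact ℓ.Prime],
      W.artinConductorExponent_tate_eq_conductorExponent_of_isElliptic ℓ)
    (hDS : dokchitserStevens_maninDatum_of_pIsogeny)
    (hp5 : 5 ≤ p) (φ₁ : Isogeny W₀ W₁) (φ₂ : Isogeny W₁ W₂) (hdeg₁ : φ₁.degree = p) (hdeg₂ : φ₂.degree = p)
    (hmult₀ : W₀.HasMultiplicativeReductionAtPrime p) (hmult₁ : W₁.HasMultiplicativeReductionAtPrime p)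
    (hs₂ : W₂.HasSplitMultiplicativeReductionAtPrime p)
    (hj₁ : padicValRat p W₀.j = p * padicValRat p W₁.j) (hj₂ : padicValRat p W₁.j = p * padicValRat p W₂.j)
    (hv : ¬ p ∣ padicValInt p W₂.minimalDiscriminantInt)
    (hMCB : ∀ (W' : WeierstrassCurve ℚ) [W'.IsElliptic] [W'.IsGloballyMinimal],
      CellB W' p → W'.HasSplitMultiplicativeReductionAtPrime p → MazurMainConjectureAt W' p)
    (hr : W₂.analyticRank = 1) (hMan₀ : HasPrimeToManinDatum W₀ p) (h3 : SplitIMCEqOnTreeInt W₂ p)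
    (W : WeierstrassCurve ℚ) [W.IsElliptic] [W.IsGloballyMinimal] (hW : IsIsogenous W W₀) : BSDp W p := by
  have hp : p.Prime := Fact.out
  have hp2 : p ≠ 2 := by omega
  have hmod : hasEntireLFunction_rat := hasEntireLFunction_rat_of_exists_isNewformOf hnf
  have h01 : IsIsogenous W₀ W₁ := ⟨φ₁⟩
  have h12 : IsIsogenous W₁ W₂ := ⟨φ₂⟩
  have hiso : IsIsogenous W₀ W₂ := h01.trans' h12
  have hred₂ : ¬ W₂.HasIrreducibleModPGaloisRep p :=
    not_hasIrreducibleModPGaloisRep_of_isIsogenous h12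
      (not_hasIrreducibleModPGaloisRep_of_isogeny_degree_eq φ₂ hdeg₂)
  have hc₂ : CellC W₂ p := ⟨hr, hp2, hred₂, hs₂.hasMultiplicativeReductionAtPrime⟩
  have hMan₂ : HasPrimeToManinDatum W₂ p :=
    hasPrimeToManinDatum_of_pIsogeny_chain2 hDS hMan₀ φ₁ φ₂ hdeg₁ hdeg₂ hmult₀ hmult₁ hj₁ hj₂
      (conductorNorm_eq_of_isIsogenous_of_tate hOS W₀ W₁ h01).symm
      (conductorNorm_eq_of_isIsogenous_of_tate hOS W₁ W₂ h12).symm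
  have h0 : ∀ Q₀ : (W₂.baseChange ℚ_[p]).toAffine.Point, p • Q₀ = 0 → Q₀ = 0 :=
    X11b.LocalTorsion.localTorsion_eq_zero_of_mult W₂ p (by omega) hc₂.2.2.2 (Or.inr hv)
  have hCTL₂ : SplitControlOnTree W₂ p :=
    splitControlOnTree_of_cellC_of_noPadicPTorsion W₂ p hGZK hnf hPT hPT2 hEP hcd hBr hc₂ h0
  have hb₂ : BSDp W₂ p :=
    bsdp_of_cellC_of_split_of_manin_of_pNewValue_of_imcInt_of_ctl W₂ p hGV hWu hJs hJn hHs hHn hpar hGS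
      hnf hH hCS hGZ hKo hHP hGZK hHL hp5 hc₂ hs₂ hMan₂ h3 hCTL₂ hMCB
  exact bsdp_of_isIsogenous_of_bsdp hCassels hGZK hmod W₂ W (hW.trans' hiso).symm_of_charZero p
    (by rw [hc₂.1]) hb₂

end TwoStep

end Summit.BirchSwinnertonDyer.Rank1Residual.X2

end
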